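import Literature.MathematicalPhysics.QuantumFieldTheory.Balaban1983to89.B13CoerciveAlongPencil

/-!
# `Balaban1983to89.B13InverseLettersOnCoerciveBall` — T. Bałaban, *Propagators for lattice gauge theories in a background field*, Commun. Math. Phys. **99**
# (1985) 389–434 [Balaban1985BackgroundPropagators], (3.26)–(3.27) p. 395, Thm 3.3 p. 399, Thm 3.4 p. 400 («The extended operators satisfy all the inequalities of
# Theorems 3.1–3.3 correspondingly. In fact we prove quantitative statements which are more precise, describing these analytic extensions as small perturbations
# of the operators depending on U only»), (3.84)–(3.86) p. 407, Thm 3.10 (3.107)–(3.108) p. 416, Thm 3.11 p. 416; [Balaban1988RG2Cluster] (2.5)–(2.7) pp. 12–13,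
# p. 15; M. Aizenman, S. Warzel, *Random operators* (2015) [AizenmanWarzel2015] §10.3 (Combes–Thomas):
# ★★★ THE DIRECT ROAD TO THE INVERSE's PENCIL LETTERS ON THE WHOLE COERCIVITY BALL — for a holomorphic operator family whose product-basis matrices carry
# (3.108)-letters `(R, ρ, B)` and whose centre is `m`-coercive, the family is `(m − 2·S·R′∕R)`-coercive on the concentric ball `‖u‖ < R′` (module
# `B13CoerciveAlongPencil`), hence invertible there with Combes–Thomas entry decay AT EVERY POINT (n10-w2 g3's
# `isUnit_and_norm_toMatrix_ringInverse_le_of_trIP_coercive_fibre`), and the inverse's entries are holomorphic by Cramer (`B13Sqrt27Accretive.differentiableOn_inv_apply`):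
# `RawEntryLetters (u ↦ toMatrix B′ B′ (T u)⁻¹) loc R′ κ (4∕(m − 2·S·R′∕R))` on the radius `R′` ITSELF — no thin radius, no Neumann series from the centre, no
# two-constants rate loss; applied to NODE 00's `G = Δ_a⁻¹` along pv27's pencil.

[folklore] bookkeeping over cited tree theorems (the lane's module 83 + 56A, n10-w2 g2∕g3's coordinates ∕ Combes–Thomas files, `B13Sqrt27Accretive` §6) BY NAME; THEOREMS
ONLY (no `def`, no `structure`, no instance, no notation); NOTHING of NODE 00's ∕ N06's is modified or restated; nothing here is a claim about the Yang–Mills mass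
gap; no node is discharged; count-neutral.

WHY THIS FILE (cell `pub-ymgap`, HUMAN RULING D-0062, Track A node N10 = [B13]; seat `pub-ymgap-dag-n10-c` g16, the N10 LANE OWNER, module 84).  The v4 inverse road's
G-junction of record (n10-w2 g2 `B13InverseOperatorCoordinates.rawEntryLetters_toMatrix_GAY_prodCfg_located` → g3 `B13GreenCentreDecayOfCoercive.…_located_of_coercive(_flat)`
→ n10-w4 g5's located `B13GreenStation(Coercive)Located`) produces the letters of `A′ ↦ G(e^{iηA′}U₀)` from Δ_a's pencil letters `(R, ρ, B_Δ)` and the centre's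
coercivity `m` on the THIN radius `R∕(4·B_Δ·(4∕m)·c_V² + 1)` (a Neumann series around the centre's inverse).  Module 83 showed that coercivity itself survives
on the much larger ball `2·B_Δ·c_V·R′ < m·R`; on that ball the inverse exists pointwise and n10-w2's Combes–Thomas theorem applies AT EACH POINT with the
centre's role played by the point — so the inverse's letters hold on the coercivity ball directly, radius `R′` up to `m·R∕(2·B_Δ·c_V)` (`c_V = m_F·c₀(1,ρ)^ν`;
e.g. `R′ = mR∕(4B_Δc_V)` keeps the margin `m∕2` — against the thin radius `≈ mR∕(16·B_Δ·c_V′²)`, `c_V′ = m_F·c₀(1,(κ−ρ′)∕3)^ν ≥ c_V`, a gain of order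
`4c_V′²∕c_V ≥ 4`), constant `4∕(m − 2B_Δc_VR′∕R)`, rate from the same Combes–Thomas window.  A quantitative improvement of the junction's G-station and
a simpler road; N06 content unchanged (the centre's coercivity — or, by module 82, Theorem 3.11's clause + Theorem 3.3's (3.46)–(3.47) at the centre).

WHAT THIS FILE PROVES (all `theorem`s; `B′` = the product basis of matrix units over `S`).
* §1 (generic holomorphic family `T : E → Module.End ℂ (S → M_N(ℂ))`, torus locations) `isUnit_of_coer_pos` (coercive with `0 < m` ⟹ a unit),
  ★★★ `rawEntryLetters_ringInverse_of_coer_centre_letters`: `RawEntryLetters (u ↦ toMatrix B′ B′ (T u)) loc R ρ B` (`0 < ρ`), fibre bound `m_F`, centre coercivity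
  `m·⟨Ψ,Ψ⟩₁ ≤ ⟨Ψ,T(0)Ψ⟩₁`, radii `0 ≤ R′ ≤ R` with margin `m′ := m − 2·(B·(m_F·c₀(1,ρ)^ν))·R′∕R > 0`, a Combes–Thomas rate `0 ≤ κ ≤ ρ∕4` with
  `8·B·κ·(m_F·c₀(1,ρ∕2)^ν) ≤ m′·ρ` ⟹ `RawEntryLetters (u ↦ toMatrix B′ B′ (Ring.inverse (T u))) loc R′ κ (4∕m′)`.
* §2 (NODE 00's `G = Δ_a⁻¹` along pv27's pencil, ANY letters `parS parB Gp`, ANY background `U₀`) ★★★ `rawEntryLetters_toMatrix_GAY_prodCfg_of_coer_centre_ball` (§1 at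
  `T u := Δ_a(e^{iηu}U₀)`, `G = Ring.inverse Δ_a` by definition); ★★★ `rawEntryLetters_toMatrix_GAY_parSymY_prodCfg_ball_of_posDefTr_of_formBound` (v4 letters,
  `G ≤ U(N)`, `G`-valued `U₀`: the centre's `m = B⁻¹` from Theorem 3.11's clause + Theorem 3.3's (3.46)–(3.47) by module 82).
HONEST FRAMING: [folklore] bookkeeping + compositions; Δ_a's pencil letters and the centre's coercivity (or print's two statements at the centre) are DISPLAYED —
the junction's ∕ N06's, NOT proved here; the ball is in the CHART around `U₀`, not print's class (3.35); finite-lattice constants, not print's `O(1)`; print's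
multi-scale rate (3.42) is NOT claimed; nothing of Bałaban's asserted beyond the cited theorems; N06 ∕ N10 NOT discharged; K1⁹ NOT closed; counts unmoved (typed
28∕28 · discharged 5∕27); 0 `def`, 0 `sorry`, standard axioms; one finite 𝕋⁴ programme at fixed ε — R4 closes the conditional finite-𝕋⁴ rung `BalabanLadder.UV`
only; the YM mass gap (Clay) is NOT proved by any of this; nothing continuum ∕ ℝ⁴ ∕ OS.  Filed `--kind proof --supports` K1⁹ (stmt-QuantumFields-27364), Literature lane.

References: T. Bałaban, CMP 99 (1985) 389–434 [Balaban1985BackgroundPropagators] (3.26)–(3.27) p.395, (3.46)–(3.47) p.398, Thm 3.3 p.399, Thm 3.4 p.400, (3.84)–(3.86) p.407,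
Thm 3.10 (3.107)–(3.108) pp.415–416, Thm 3.11 p.416; CMP 116 (1988) 1–22 [Balaban1988RG2Cluster] (2.5)–(2.7) pp.12–13, p.15; CMP 96 (1984) 223–250
[Balaban1984PropagatorsII] p.226, Lemma 2.1 (2.61) p.234; M. Aizenman, S. Warzel (2015) [AizenmanWarzel2015] §10.3.
-/

noncomputable section

namespace Literature.MathematicalPhysics.QuantumFieldTheory.Balaban1983to89.B13InverseLettersOnCoerciveBall

open Metric Set Finset Module
open scoped Matrix Matrix.Norms.L2Operator
open Literature.MathematicalPhysics.QuantumFieldTheory.Balaban1983to89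
open Literature.MathematicalPhysics.QuantumFieldTheory.Balaban1983to89.B9Thm37GlueTorus (tdist1)
open Literature.MathematicalPhysics.QuantumFieldTheory.Balaban1983to89.B5TorusCover (UT)
open Literature.MathematicalPhysics.QuantumFieldTheory.Balaban1983to89.B9Thm311ReadingCoords (trIP PosDefTr isUnit_of_posDefTr)
open Literature.MathematicalPhysics.QuantumFieldTheory.Balaban1983to89.B13EntrywiseWalks (RawEntryLetters)
open Literature.MathematicalPhysics.QuantumFieldTheory.Balaban1983to89.B13GreenCentreDecayOfCoercive (isUnit_and_norm_toMatrix_ringInverse_le_of_trIP_coercive_fibre)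
open Literature.MathematicalPhysics.QuantumFieldTheory.Balaban1983to89.B13InverseOperatorCoordinates (toMatrix_ringInverse)
open Literature.MathematicalPhysics.QuantumFieldTheory.Balaban1983to89.B13Sqrt27Accretive (differentiableOn_inv_apply)
open Literature.MathematicalPhysics.QuantumFieldTheory.Balaban1983to89.B13CoerciveAlongPencil (coer_ball_of_coer_centre_letters posDefTr_one_of_coer)
open Literature.MathematicalPhysics.QuantumFieldTheory.Balaban1983to89.B13CoerciveOfInverseFormBound (trIP_deltaAY_parSymY_ge_of_posDefTr_of_GAY_formBound)
open Literature.MathematicalPhysics.QuantumFieldTheory.Balaban1983to89.B9Eq39Adjoint (prodCfg)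
open Literature.MathematicalPhysics.QuantumFieldTheory.Balaban1983to89.B9Eq369Product (prodCfg_zero)
open Literature.MathematicalPhysics.QuantumFieldTheory.Balaban1983to89.B6GlobalChartV1 (PV)
open Literature.MathematicalPhysics.QuantumFieldTheory.Balaban1983to89.B6KLevelCensusIndexV1 (KIdx)
open Literature.MathematicalPhysics.QuantumFieldTheory.Balaban1983to89.Node00

/-! ## §1. ★★★ Inverse letters on the whole coercivity ball (generic holomorphic operator families) -/

section Generic

variable {S : Type} [Fintype S] [DecidableEq S] {N : ℕ}
variable {ν : ℕ} {Nf : Fin ν → ℕ} [∀ j, NeZero (Nf j)]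
variable {E : Type*} [NormedAddCommGroup E] [NormedSpace ℂ E]

omit [DecidableEq S] in
/-- a coercive operator with a positive constant (flat trace pairing) is a unit of `Module.End ℂ`. [cite: Balaban1985BackgroundPropagators, Thm 3.11 p.416, (3.27) p.395; folklore] -/
theorem isUnit_of_coer_pos (T : Module.End ℂ (S → Matrix (Fin N) (Fin N) ℂ)) {m : ℝ} (hm : 0 < m)
    (hco : ∀ Ψ : S → Matrix (Fin N) (Fin N) ℂ, m * trIP (fun _ => (1 : ℝ)) Ψ Ψ ≤ trIP (fun _ => (1 : ℝ)) Ψ (T Ψ)) : IsUnit T :=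
  isUnit_of_posDefTr (posDefTr_one_of_coer T hm hco)

/-- ★★★ **THE INVERSE's ENTRY LETTERS ON THE WHOLE COERCIVITY BALL.**  Let `T : E → Module.End ℂ (S → M_N(ℂ))` carry the product-basis letters
`RawEntryLetters (u ↦ toMatrix B′ B′ (T u)) loc R ρ B` (`0 < ρ`), `loc` with fibres `≤ m_F`, and a coercive centre `m·⟨Ψ,Ψ⟩₁ ≤ ⟨Ψ, T(0)Ψ⟩₁`.  For radii `0 ≤ R′ ≤ R`
with positive margin `m′ = m − 2·(B·(m_F·c₀(1,ρ)^ν))·R′∕R` and a Combes–Thomas rate `0 ≤ κ ≤ ρ∕4`, `8·B·κ·(m_F·c₀(1,ρ∕2)^ν) ≤ m′·ρ`: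
`RawEntryLetters (u ↦ toMatrix B′ B′ (Ring.inverse (T u))) loc R′ κ (4∕m′)` — coercivity on the ball (module 83), Combes–Thomas AT EACH POINT (n10-w2 g3), holomorphy of
the inverse's entries by Cramer (`differentiableOn_inv_apply`) through `toMatrix_ringInverse`.
[cite: Balaban1985BackgroundPropagators, Thm 3.4 p.400, (3.84)–(3.86) p.407, Thm 3.10 (3.108) p.416, Thm 3.11 p.416; Balaban1988RG2Cluster, (2.7) p.13, p.15;
Balaban1984PropagatorsII, Lemma 2.1 (2.61) p.234; AizenmanWarzel2015, §10.3] -/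
theorem rawEntryLetters_ringInverse_of_coer_centre_letters (T : E → Module.End ℂ (S → Matrix (Fin N) (Fin N) ℂ))
    {loc : S × (Fin N × Fin N) → UT Nf} {R R' ρ B m : ℝ}
    (hA : RawEntryLetters (fun u => LinearMap.toMatrix
        ((Pi.basis fun _ : S => Matrix.stdBasis ℂ (Fin N) (Fin N)).reindex (Equiv.sigmaEquivProd S (Fin N × Fin N)))
        ((Pi.basis fun _ : S => Matrix.stdBasis ℂ (Fin N) (Fin N)).reindex (Equiv.sigmaEquivProd S (Fin N × Fin N))) (T u)) loc R ρ B)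
    (hρ : 0 < ρ) {mF : ℕ} (hfib : ∀ y : UT Nf, (univ.filter fun k => loc k = y).card ≤ mF)
    (hco : ∀ Ψ : S → Matrix (Fin N) (Fin N) ℂ, m * trIP (fun _ => (1 : ℝ)) Ψ Ψ ≤ trIP (fun _ => (1 : ℝ)) Ψ (T 0 Ψ))
    (hR' : 0 ≤ R') (hR'R : R' ≤ R) (hmarg : 0 < m - 2 * (B * (mF * B6.c0 1 ρ ^ ν)) * R' / R)
    {κ : ℝ} (hκ : 0 ≤ κ) (hκ4 : κ ≤ ρ / 4)
    (hκm : 8 * B * κ * (mF * B6.c0 1 (ρ / 2) ^ ν) ≤ (m - 2 * (B * (mF * B6.c0 1 ρ ^ ν)) * R' / R) * ρ) :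
    RawEntryLetters (fun u => LinearMap.toMatrix
        ((Pi.basis fun _ : S => Matrix.stdBasis ℂ (Fin N) (Fin N)).reindex (Equiv.sigmaEquivProd S (Fin N × Fin N)))
        ((Pi.basis fun _ : S => Matrix.stdBasis ℂ (Fin N) (Fin N)).reindex (Equiv.sigmaEquivProd S (Fin N × Fin N))) (Ring.inverse (T u))) loc R'
      κ (4 / (m - 2 * (B * (mF * B6.c0 1 ρ ^ ν)) * R' / R)) := by
  set m' : ℝ := m - 2 * (B * (mF * B6.c0 1 ρ ^ ν)) * R' / R with hm'
  -- coercivity with margin `m'` at every point of the ball (module 83)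
  have hball := coer_ball_of_coer_centre_letters T hA hρ hfib hco hR' hR'R
  -- Combes–Thomas at each point: unit + entry decay of the inverse
  have hΘ : ∀ s t : S, Real.sqrt ((fun _ : S => (1 : ℝ)) s) ≤ 1 * Real.sqrt ((fun _ : S => (1 : ℝ)) t) := fun _ _ => by rw [one_mul]
  have hpt : ∀ u ∈ ball (0 : E) R', IsUnit (T u) ∧ ∀ p q, ‖LinearMap.toMatrix
      ((Pi.basis fun _ : S => Matrix.stdBasis ℂ (Fin N) (Fin N)).reindex (Equiv.sigmaEquivProd S (Fin N × Fin N)))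
      ((Pi.basis fun _ : S => Matrix.stdBasis ℂ (Fin N) (Fin N)).reindex (Equiv.sigmaEquivProd S (Fin N × Fin N))) (Ring.inverse (T u)) p q‖ ≤
        1 * (4 / m') * Real.exp (-(κ * tdist1 Nf (loc p) (loc q))) := by
    intro u hu
    have huR : u ∈ ball (0 : E) R := mem_ball_zero_iff.2 ((mem_ball_zero_iff.1 hu).trans_le hR'R)
    exact isUnit_and_norm_toMatrix_ringInverse_le_of_trIP_coercive_fibre (fun _ : S => (1 : ℝ)) (fun _ => one_pos) hΘ (T u) hmarg
      (hball u hu) loc hfib hA.B_nonneg hρ (hA.decay u huR) hκ hκ4 (by rw [one_mul]; exact hκm)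
  refine ⟨fun u hu p q => ?_, fun p q => ?_, by positivity⟩
  · have h := (hpt u hu).2 p q
    rwa [one_mul] at h
  · -- holomorphy of the inverse's entries: Cramer on the product-basis matrix, a unit at every point of the ball
    have hholo := differentiableOn_inv_apply (s := ball (0 : E) R')
      (A := fun u => LinearMap.toMatrix
        ((Pi.basis fun _ : S => Matrix.stdBasis ℂ (Fin N) (Fin N)).reindex (Equiv.sigmaEquivProd S (Fin N × Fin N)))
        ((Pi.basis fun _ : S => Matrix.stdBasis ℂ (Fin N) (Fin N)).reindex (Equiv.sigmaEquivProd S (Fin N × Fin N))) (T u))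
      (fun i j => (hA.holo i j).mono (ball_subset_ball hR'R)) (fun u hu => ?_) p q
    · refine hholo.congr fun u _ => ?_
      simp only [toMatrix_ringInverse]
    · exact (Matrix.isUnit_iff_isUnit_det _).mp ((LinearMap.isUnit_toMatrix_iff _).mpr (hpt u hu).1)

end Generic

/-! ## §2. ★★★ NODE 00's `G = Δ_a⁻¹` along pv27's pencil: letters on the whole coercivity ball -/

section Pencil

variable {d ℓ : ℕ} {hd : 1 ≤ d + 1} {hL : Odd (ℓ + 1) ∧ 1 < ℓ + 1} {b₀ b₁ : ℝ}
variable (i : KIdx d ℓ hd hL b₀ b₁) {N : ℕ} {G : Subgroup (Matrix (Fin N) (Fin N) ℂ)ˣ}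
variable {ν : ℕ} {Nf : Fin ν → ℕ} [∀ j, NeZero (Nf j)]

/-- ★★★ **THE G-JUNCTION ON THE WHOLE COERCIVITY BALL** (ANY letters `parS parB Gp`, ANY background `U₀`): Δ_a's pencil letters
`hA : RawEntryLetters (A′ ↦ toMatrix B′ B′ (Δ_a(e^{iηA′}U₀))) loc R ρ B_Δ` (`0 < ρ`), a fibre bound `m_F` of `loc`, the centre's coercivity
`m·⟨Ψ,Ψ⟩₁ ≤ ⟨Ψ, Δ_a(U₀)Ψ⟩₁`, radii `0 ≤ R′ ≤ R` with margin `m′ = m − 2·(B_Δ·(m_F·c₀(1,ρ)^ν))·R′∕R > 0`, a Combes–Thomas rate `0 ≤ κ ≤ ρ∕4` with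
`8·B_Δ·κ·(m_F·c₀(1,ρ∕2)^ν) ≤ m′·ρ` ⟹ `RawEntryLetters (A′ ↦ toMatrix B′ B′ (G(e^{iηA′}U₀))) loc R′ κ (4∕m′)` — on the radius `R′` itself (`G = Ring.inverse Δ_a` by
NODE 00's definition). [cite: Balaban1985BackgroundPropagators, (3.26)–(3.27) p.395, Thm 3.3 p.399, Thm 3.4 p.400, (3.84)–(3.86) p.407, Thm 3.10 (3.108) p.416, Thm 3.11 p.416;
Balaban1988RG2Cluster, (2.5)–(2.7) pp.12–13, p.15; Balaban1984PropagatorsII, Lemma 2.1 (2.61) p.234; AizenmanWarzel2015, §10.3] -/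
theorem rawEntryLetters_toMatrix_GAY_prodCfg_of_coer_centre_ball (parS : SiteParY (Matrix (Fin N) (Fin N) ℂ) i)
    (parB : BondParY (Matrix (Fin N) (Fin N) ℂ) i) (Gp : SiteOpY (Matrix (Fin N) (Fin N) ℂ) i) (U₀ : CfgY (Matrix (Fin N) (Fin N) ℂ) i) (η : ℝ)
    {loc : FBondY i × (Fin N × Fin N) → UT Nf} {R R' ρ BΔ m : ℝ}
    (hA : RawEntryLetters (fun a : Fin (d + 1) → Site (PV d ℓ i.m i.K hd hL) 0 → Matrix (Fin N) (Fin N) ℂ =>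
      LinearMap.toMatrix
        ((Pi.basis fun _ : FBondY i => Matrix.stdBasis ℂ (Fin N) (Fin N)).reindex (Equiv.sigmaEquivProd (FBondY i) (Fin N × Fin N)))
        ((Pi.basis fun _ : FBondY i => Matrix.stdBasis ℂ (Fin N) (Fin N)).reindex (Equiv.sigmaEquivProd (FBondY i) (Fin N × Fin N)))
        (deltaAY i parS parB Gp (prodCfg U₀ η a))) loc R ρ BΔ)
    (hρ : 0 < ρ) {mF : ℕ} (hfib : ∀ y : UT Nf, (univ.filter fun k => loc k = y).card ≤ mF)
    (hco : ∀ Ψ : FBondY i → Matrix (Fin N) (Fin N) ℂ, m * trIP (fun _ => (1 : ℝ)) Ψ Ψ ≤ trIP (fun _ => (1 : ℝ)) Ψ (deltaAY i parS parB Gp U₀ Ψ))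
    (hR' : 0 ≤ R') (hR'R : R' ≤ R) (hmarg : 0 < m - 2 * (BΔ * (mF * B6.c0 1 ρ ^ ν)) * R' / R)
    {κ : ℝ} (hκ : 0 ≤ κ) (hκ4 : κ ≤ ρ / 4)
    (hκm : 8 * BΔ * κ * (mF * B6.c0 1 (ρ / 2) ^ ν) ≤ (m - 2 * (BΔ * (mF * B6.c0 1 ρ ^ ν)) * R' / R) * ρ) :
    RawEntryLetters (fun a : Fin (d + 1) → Site (PV d ℓ i.m i.K hd hL) 0 → Matrix (Fin N) (Fin N) ℂ =>
        LinearMap.toMatrix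
          ((Pi.basis fun _ : FBondY i => Matrix.stdBasis ℂ (Fin N) (Fin N)).reindex (Equiv.sigmaEquivProd (FBondY i) (Fin N × Fin N)))
          ((Pi.basis fun _ : FBondY i => Matrix.stdBasis ℂ (Fin N) (Fin N)).reindex (Equiv.sigmaEquivProd (FBondY i) (Fin N × Fin N)))
          (GAY i parS parB Gp (prodCfg U₀ η a))) loc R'
      κ (4 / (m - 2 * (BΔ * (mF * B6.c0 1 ρ ^ ν)) * R' / R)) := by
  have hco0 : ∀ Ψ : FBondY i → Matrix (Fin N) (Fin N) ℂ,
      m * trIP (fun _ => (1 : ℝ)) Ψ Ψ ≤ trIP (fun _ => (1 : ℝ)) Ψ (deltaAY i parS parB Gp (prodCfg U₀ η 0) Ψ) := by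
    intro Ψ; rw [prodCfg_zero]; exact hco Ψ
  exact rawEntryLetters_ringInverse_of_coer_centre_letters (fun a => deltaAY i parS parB Gp (prodCfg U₀ η a)) hA hρ hfib hco0 hR' hR'R hmarg hκ hκ4 hκm

/-- ★★★ **… WITH THE CENTRE SUPPLIED BY PRINT's TWO STATEMENTS** (v4 letters `parSymY ∕ parBY ∕ G′ = GpY parSymY`, `G ≤ U(N)`, `G`-valued `U₀`): Theorem 3.11's clause
`PosDefTr 1 (Δ_a(U₀))` + Theorem 3.3's (3.46)–(3.47) form bound `⟨Φ, G(U₀)Φ⟩₁ ≤ B·⟨Φ,Φ⟩₁` (`0 < B`) give the centre's `m = B⁻¹` (module 82); with Δ_a's pencil letters, a fibre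
bound and the window (margin `m′ = B⁻¹ − 2·(B_Δ·(m_F·c₀(1,ρ)^ν))·R′∕R > 0`, `8·B_Δ·κ·(m_F·c₀(1,ρ∕2)^ν) ≤ m′·ρ`): `RawEntryLetters (A′ ↦ toMatrix B′ B′ (G(e^{iηA′}U₀))) loc R′ κ (4∕m′)`.
[cite: Balaban1985BackgroundPropagators, (3.26)–(3.27) p.395, (3.46)–(3.47) p.398, Thm 3.3 p.399, Thm 3.4 p.400, Thm 3.10 (3.108) p.416, Thm 3.11 p.416; Balaban1988RG2Cluster, p.15;
AizenmanWarzel2015, §10.3] -/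
theorem rawEntryLetters_toMatrix_GAY_parSymY_prodCfg_ball_of_posDefTr_of_formBound
    (hG : G ≤ B7Prop2Explicit.unitaryUnits (Matrix (Fin N) (Fin N) ℂ))
    {U₀ : CfgY (Matrix (Fin N) (Fin N) ℂ) i} (hU : ∀ μ x, U₀ μ x ∈ G) (η : ℝ)
    {loc : FBondY i × (Fin N × Fin N) → UT Nf} {R R' ρ BΔ : ℝ}
    (hA : RawEntryLetters (fun a : Fin (d + 1) → Site (PV d ℓ i.m i.K hd hL) 0 → Matrix (Fin N) (Fin N) ℂ =>
      LinearMap.toMatrix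
        ((Pi.basis fun _ : FBondY i => Matrix.stdBasis ℂ (Fin N) (Fin N)).reindex (Equiv.sigmaEquivProd (FBondY i) (Fin N × Fin N)))
        ((Pi.basis fun _ : FBondY i => Matrix.stdBasis ℂ (Fin N) (Fin N)).reindex (Equiv.sigmaEquivProd (FBondY i) (Fin N × Fin N)))
        (deltaAY i (parSymY i) (parBY i) (GpY i (parSymY i)) (prodCfg U₀ η a))) loc R ρ BΔ)
    (hρ : 0 < ρ) {mF : ℕ} (hfib : ∀ y : UT Nf, (univ.filter fun k => loc k = y).card ≤ mF)
    -- print's two statements at the centre: Theorem 3.11's clause (row 17) and Theorem 3.3's (3.46)–(3.47) for `G`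
    (hpd : PosDefTr (fun _ => (1 : ℝ)) (deltaAY i (parSymY i) (parBY i) (GpY i (parSymY i)) U₀))
    {B : ℝ} (hB : 0 < B)
    (hGB : ∀ Φ : FBondY i → Matrix (Fin N) (Fin N) ℂ,
      trIP (fun _ => (1 : ℝ)) Φ (GAY i (parSymY i) (parBY i) (GpY i (parSymY i)) U₀ Φ) ≤ B * trIP (fun _ => (1 : ℝ)) Φ Φ)
    (hR' : 0 ≤ R') (hR'R : R' ≤ R) (hmarg : 0 < B⁻¹ - 2 * (BΔ * (mF * B6.c0 1 ρ ^ ν)) * R' / R)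
    {κ : ℝ} (hκ : 0 ≤ κ) (hκ4 : κ ≤ ρ / 4)
    (hκm : 8 * BΔ * κ * (mF * B6.c0 1 (ρ / 2) ^ ν) ≤ (B⁻¹ - 2 * (BΔ * (mF * B6.c0 1 ρ ^ ν)) * R' / R) * ρ) :
    RawEntryLetters (fun a : Fin (d + 1) → Site (PV d ℓ i.m i.K hd hL) 0 → Matrix (Fin N) (Fin N) ℂ =>
        LinearMap.toMatrix
          ((Pi.basis fun _ : FBondY i => Matrix.stdBasis ℂ (Fin N) (Fin N)).reindex (Equiv.sigmaEquivProd (FBondY i) (Fin N × Fin N)))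
          ((Pi.basis fun _ : FBondY i => Matrix.stdBasis ℂ (Fin N) (Fin N)).reindex (Equiv.sigmaEquivProd (FBondY i) (Fin N × Fin N)))
          (GAY i (parSymY i) (parBY i) (GpY i (parSymY i)) (prodCfg U₀ η a))) loc R'
      κ (4 / (B⁻¹ - 2 * (BΔ * (mF * B6.c0 1 ρ ^ ν)) * R' / R)) :=
  rawEntryLetters_toMatrix_GAY_prodCfg_of_coer_centre_ball i (parSymY i) (parBY i) (GpY i (parSymY i)) U₀ η hA hρ hfib
    (trIP_deltaAY_parSymY_ge_of_posDefTr_of_GAY_formBound i hG hU hpd hB hGB) hR' hR'R hmarg hκ hκ4 hκm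

end Pencil

end Literature.MathematicalPhysics.QuantumFieldTheory.Balaban1983to89.B13InverseLettersOnCoerciveBall

end
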